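import Summits.ValiantsHypothesis.ValiantsHypothesis.Theorems.LacunarySymmetroidMatrixDescartesCensusPivotTwoGapLaw
import Summits.ValiantsHypothesis.ValiantsHypothesis.Theorems.LacunarySymmetroidMatrixDescartesCensusSignVariationsWindow

/-!
# `MatrixDescartes` census — the `m = 2` pivot row with END CORRECTIONS: `Z₊ + [lead < 0] + [trail < 0] ≤ 2K + 2` always,
# `≤ 2K` off the interleaving locus (any `K`, any PSD letters, any pivot)

HONEST FRAMING.  Object-search cell `pub-symmetroid`, seat `val-sym-mdr-p1` (generation 13); helper file `--supports` the crux item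
stmt-ValiantsHypothesis-18050 (`Theses.LacunarySymmetroid.MatrixDescartes`, OPEN, on HOLD) with NO closure claim.  Companion of
`…CensusPivotTwoGapLaw` (`Z₊ ≤ 2K` off the interleaving locus) and `…CensusSignVariationsWindow` (two-ended budget / window lemma):
the same counts keep track of the signs of the LOWEST and HIGHEST coefficients of `det F`.  This is the mechanism behind «both end
islands unbounded» for two-direction pencils (val-sym-mdr-p1 g12, BLOCKS.md): in a sign-separated two-direction hard-cell pencil the
extreme coefficients are `m(J,u)·(u-weights at the lowest exponent) < 0` and `m(J,v)·(…) < 0`, so each end costs one variation.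

* `posRoots_two_ended_le` — for `F = X^e J + ∑ₖ X^{dₖ} Pₖ` (`Pₖ ⪰ 0`, `J` any real `2 × 2`):
  `Z₊ + [lead (det F) < 0] + [trail (det F) < 0] ≤ 2K + 2` (negative coefficients only at the `K + 1` pivot-type degrees, tree
  `TwoDescartes.coeff_det_nonneg_of_not_mem`, and the two-ended budget `Census.signVariations_two_ended_le`);
* `posRoots_two_ended_le_of_gap` — under the gap hypothesis of `TwoGap.posRoots_le_two_mul_of_gap` (two pivot-type degrees with no
  pivot-type and no letter-pair degree strictly between them): `Z₊ + [lead < 0] + [trail < 0] ≤ 2K`.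
So a pencil with both extreme coefficients negative has `Z₊ ≤ 2K`, and `≤ 2K − 2` off the interleaving locus — the count that makes the
BLOCK `(2,2)` LAW (`…PivotTwoDirectionsBlockLawAll`) and is the Descartes half of the BLOCK QUESTION «two directions ⇒ `2K − 2`» for
every `(K_u, K_v)` (the interleaving chambers excepted).  Nothing here bears on `MatrixDescartes` in its window, on `DoorA26` / `DoorA34`,
registers / credences, or `VP ≠ VNP`.

[folklore] Descartes bookkeeping; tree lemmas named above.  No definitions, no named facts.
-/

-- `Summit.ValiantsHypothesis.ValiantsHypothesis.…` repeats a component by the D-0017 layout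
-- (single-conjunct summit), which the `dupNamespace` linter flags; the name is mandated.
set_option linter.dupNamespace false

namespace Summit.ValiantsHypothesis.ValiantsHypothesis.Theorems.LacunarySymmetroidMatrixDescartes.Pivot.TwoGap

open Polynomial Matrix Finset
open scoped BigOperators

variable {K : ℕ}

/-- **`Z₊ + [lead < 0] + [trail < 0] ≤ 2K + 2`** for every `2 × 2` pivot pencil with PSD letters. [this file] -/
theorem posRoots_two_ended_le (e : ℕ) (d : Fin K → ℕ) (J : Matrix (Fin 2) (Fin 2) ℝ)
    (P : Fin K → Matrix (Fin 2) (Fin 2) ℝ) (hP : ∀ k, (P k).PosSemidef) :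
    ((Matrix.det (((X : ℝ[X]) ^ e) • J.map Polynomial.C
        + ∑ k, ((X : ℝ[X]) ^ d k) • (P k).map Polynomial.C)).roots.toFinset.filter (fun t => 0 < t)).card
      + (if (Matrix.det (((X : ℝ[X]) ^ e) • J.map Polynomial.C
          + ∑ k, ((X : ℝ[X]) ^ d k) • (P k).map Polynomial.C)).leadingCoeff < 0 then 1 else 0)
      + (if (Matrix.det (((X : ℝ[X]) ^ e) • J.map Polynomial.C
          + ∑ k, ((X : ℝ[X]) ^ d k) • (P k).map Polynomial.C)).trailingCoeff < 0 then 1 else 0)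
      ≤ 2 * K + 2 := by
  classical
  rw [TwoDescartes.pencil_eq_sum]
  set g := Matrix.det (∑ l, ((X : ℝ[X]) ^ TwoDescartes.expo e d l) • (TwoDescartes.letter J P l).map Polynomial.C)
    with hg
  let T : Finset ℕ := Finset.univ.image (fun l : Option (Fin K) => e + TwoDescartes.expo e d l)
  have hT : T.card ≤ K + 1 := by
    refine le_trans Finset.card_image_le ?_
    simp [Fintype.card_option]
  have hsub : Pivot.TwoDescartes.negSupp g ⊆ T := by
    intro n hn
    simp only [Pivot.TwoDescartes.negSupp, Finset.mem_filter] at hn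
    by_contra hnot
    have hn' : ∀ l, e + TwoDescartes.expo e d l ≠ n := by
      intro l hl
      exact hnot (Finset.mem_image.mpr ⟨l, Finset.mem_univ _, hl⟩)
    exact absurd hn.2 (not_lt.mpr (TwoDescartes.coeff_det_nonneg_of_not_mem e d J P hP n hn'))
  have hb := Census.signVariations_two_ended_le g
  have hc := Finset.card_le_card hsub
  have hZ := Census.card_posRoots_le_signVariations g
  omega

/-- **`Z₊ + [lead < 0] + [trail < 0] ≤ 2K` off the interleaving locus** (gap hypotheses of `posRoots_le_two_mul_of_gap`). [this file] -/
theorem posRoots_two_ended_le_of_gap (e : ℕ) (d : Fin K → ℕ) (J : Matrix (Fin 2) (Fin 2) ℝ)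
    (P : Fin K → Matrix (Fin 2) (Fin 2) ℝ) (hP : ∀ k, (P k).PosSemidef) (N N' : ℕ) (hNN' : N < N')
    (hN : N = 2 * e ∨ ∃ k, N = e + d k) (hN' : N' = 2 * e ∨ ∃ k, N' = e + d k)
    (hgap_e : ¬ (N < 2 * e ∧ 2 * e < N')) (hgap_s : ∀ k, ¬ (N < e + d k ∧ e + d k < N'))
    (hgap_p : ∀ i j, ¬ (N < d i + d j ∧ d i + d j < N')) :
    ((Matrix.det (((X : ℝ[X]) ^ e) • J.map Polynomial.C
        + ∑ k, ((X : ℝ[X]) ^ d k) • (P k).map Polynomial.C)).roots.toFinset.filter (fun t => 0 < t)).card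
      + (if (Matrix.det (((X : ℝ[X]) ^ e) • J.map Polynomial.C
          + ∑ k, ((X : ℝ[X]) ^ d k) • (P k).map Polynomial.C)).leadingCoeff < 0 then 1 else 0)
      + (if (Matrix.det (((X : ℝ[X]) ^ e) • J.map Polynomial.C
          + ∑ k, ((X : ℝ[X]) ^ d k) • (P k).map Polynomial.C)).trailingCoeff < 0 then 1 else 0)
      ≤ 2 * K := by
  classical
  rw [TwoDescartes.pencil_eq_sum]
  set g := Matrix.det (∑ l, ((X : ℝ[X]) ^ TwoDescartes.expo e d l) • (TwoDescartes.letter J P l).map Polynomial.C)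
    with hg
  let T : Finset ℕ := Finset.univ.image (fun l : Option (Fin K) => e + TwoDescartes.expo e d l)
  have hT : T.card ≤ K + 1 := by
    refine le_trans Finset.card_image_le ?_
    simp [Fintype.card_option]
  have hneg : ∀ n, g.coeff n < 0 → n ∈ T := by
    intro n hn
    by_contra hnot
    have hn' : ∀ l, e + TwoDescartes.expo e d l ≠ n := by
      intro l hl
      exact hnot (Finset.mem_image.mpr ⟨l, Finset.mem_univ _, hl⟩)
    exact absurd hn (not_lt.mpr (TwoDescartes.coeff_det_nonneg_of_not_mem e d J P hP n hn'))
  have hNT : N ∈ T := by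
    rcases hN with h | ⟨k, h⟩
    · exact Finset.mem_image.mpr ⟨none, Finset.mem_univ _, by simp [TwoDescartes.expo]; omega⟩
    · exact Finset.mem_image.mpr ⟨some k, Finset.mem_univ _, by simp [TwoDescartes.expo]; omega⟩
  have hN'T : N' ∈ T := by
    rcases hN' with h | ⟨k, h⟩
    · exact Finset.mem_image.mpr ⟨none, Finset.mem_univ _, by simp [TwoDescartes.expo]; omega⟩
    · exact Finset.mem_image.mpr ⟨some k, Finset.mem_univ _, by simp [TwoDescartes.expo]; omega⟩
  have hZ := Census.card_posRoots_le_signVariations g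
  -- Step 1: a non-negative coefficient at `N` or `N'`
  have step1 : ∀ s, s ∈ T → 0 ≤ g.coeff s →
      (g.roots.toFinset.filter (fun t => 0 < t)).card + (if g.leadingCoeff < 0 then 1 else 0)
        + (if g.trailingCoeff < 0 then 1 else 0) ≤ 2 * K := by
    intro s hs h0
    have hsub : Pivot.TwoDescartes.negSupp g ⊆ T.erase s := by
      intro n hn
      simp only [Pivot.TwoDescartes.negSupp, Finset.mem_filter] at hn
      refine Finset.mem_erase.mpr ⟨fun h => ?_, hneg n hn.2⟩
      rw [h] at hn; exact absurd hn.2 (not_lt.mpr h0)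
    have hb := Census.signVariations_two_ended_le g
    have hc := Finset.card_le_card hsub
    rw [Finset.card_erase_of_mem hs] at hc
    omega
  by_cases h1 : 0 ≤ g.coeff N
  · exact step1 N hNT h1
  by_cases h2 : 0 ≤ g.coeff N'
  · exact step1 N' hN'T h2
  push Not at h1 h2
  have hwin : ∀ m, N ≤ m → m ≤ N' → g.coeff m ≤ 0 := by
    intro m ha hb
    rcases Nat.eq_or_lt_of_le ha with h | h
    · rw [← h]; exact h1.le
    rcases Nat.eq_or_lt_of_le hb with h' | h'
    · rw [h']; exact h2.le
    refine le_of_eq (coeff_det_eq_zero_of_not_sum e d J P m fun l l' hll' => ?_)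
    rcases l with _ | i <;> rcases l' with _ | j <;> simp only [TwoDescartes.expo] at hll'
    · exact hgap_e ⟨by omega, by omega⟩
    · exact hgap_s j ⟨by omega, by omega⟩
    · exact hgap_s i ⟨by omega, by omega⟩
    · exact hgap_p i j ⟨by omega, by omega⟩
  have hw := Census.signVariations_window_two_ended g N N' hNN'.le hwin ((T.erase N).erase N')
    (fun m hm hout => by
      refine Finset.mem_erase.mpr ⟨by omega, Finset.mem_erase.mpr ⟨by omega, hneg m hm⟩⟩)
  have hc1 : ((T.erase N).erase N').card + 2 = T.card := by
    have hN'm : N' ∈ T.erase N := Finset.mem_erase.mpr ⟨by omega, hN'T⟩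
    rw [Finset.card_erase_of_mem hN'm, Finset.card_erase_of_mem hNT]
    have : 2 ≤ T.card := by
      have hsub : ({N, N'} : Finset ℕ) ⊆ T := by
        intro x hx
        simp only [Finset.mem_insert, Finset.mem_singleton] at hx
        rcases hx with rfl | rfl
        · exact hNT
        · exact hN'T
      have := Finset.card_le_card hsub
      rw [Finset.card_pair (by omega)] at this
      exact this
    omega
  omega

end Summit.ValiantsHypothesis.ValiantsHypothesis.Theorems.LacunarySymmetroidMatrixDescartes.Pivot.TwoGap
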